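import Literature.MathematicalPhysics.QuantumLattice.DWaveSourceProofs
import Literature.MathematicalPhysics.QuantumLattice.GroundStateSourceBounds
import Literature.MathematicalPhysics.QuantumLattice.FinDimSpectrumProofs
import Summits.HubbardSuperconductivity.HubbardSuperconductivity.Theorems.WcbcsSsbToTorusLRO.Negative.BlockRepulsionDominatesPairOrder
import HarnessLib

/-!
# Crux `CwSsbToEvenTorusLRO` (stmt-HubbardSuperconductivity-10439, route `ChiralWindow`), line
`griffiths-block-slope` — stub `stub_blockSlope` (S1, the two-parameter Griffiths block slope)

With `T_h = dWaveSourceTorus L U μ h` (the grand-canonical Hubbard torus with the `d`-wave source),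
`P = pairField dWaveFormFactor L`, the Kac block operator `W_R = R⁻⁴ Σ_a B_aᴴ B_a`,
`B_a = Σ_{u ∈ [0,R)²} P_{a+u}`, and `ω` the tracial ground-state functional of the base Hamiltonian
`K = T_h + κ W_R`, the stub asserts, for every finite `L`, every `R ≥ 1` and every `t ≥ 0`,

`E₀(T_h + (κ - t) W_R) - E₀(T_h + κ W_R) ≤ -t (Re ω(P))² / L²`.

Proof (finite-dimensional linear algebra):

* the variational chord `t · Re ω(W_R) ≤ E₀(K) - E₀(K - t W_R)` (the ground state of `K` is a trial
  state for `K - tW_R`; `sub_mul_re_groundStateFunctional_le` of `GroundStateSourceBounds`);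
* block coherence dominates pair order IN THE STATE: `Re ω(PᴴP) ≤ L² Re ω(W_R)`, because
  `L² W_R - PᴴP` is positive semidefinite — its quadratic form is the landed vector inequality
  `re_expect_pairIntensity_le_sq_mul_blockRepulsion` (`Σ_a B_a = R² P` and Cauchy–Schwarz) — and the
  tracial ground state is a positive functional (`groundStateFunctional_nonneg_of_posSemidef`);
* the variance bound `(Re ω(P))² ≤ |ω(P)|² ≤ Re ω(PᴴP)` (`ω((P - c)ᴴ(P - c)) ≥ 0`, `c = ω(P)`).

No definition is introduced; the helper lemmas are private. [folklore]
-/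

noncomputable section

set_option linter.dupNamespace false

namespace Summit.HubbardSuperconductivity.HubbardSuperconductivity.Theorems.CwSsbToEvenTorusLRO

open Literature.MathematicalPhysics.QuantumLattice Matrix
open Summit.HubbardSuperconductivity.WcbcsSsbToTorusLRO.Negative
open scoped Matrix ComplexOrder Matrix.Norms.L2Operator

section Abstract

variable {n : Type*} [Fintype n] [DecidableEq n]

/-- Variance bound for the tracial ground state of a Hermitian `K`: `(Re ω(X))² ≤ Re ω(Xᴴ X)` for
every `X` (expand `0 ≤ ω((X - c•1)ᴴ (X - c•1))` with `c = ω(X)`). [folklore] -/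
private theorem re_sq_le_re_conjTranspose_mul_self [Nonempty n] {K : Matrix n n ℂ}
    (hK : K.IsHermitian) (X : Matrix n n ℂ) :
    (K.groundStateFunctional X).re ^ 2 ≤ (K.groundStateFunctional (Xᴴ * X)).re := by
  set c : ℂ := K.groundStateFunctional X with hc
  have hexp : (X - c • (1 : Matrix n n ℂ))ᴴ * (X - c • 1) =
      Xᴴ * X - c • Xᴴ - (star c) • X + (c * star c) • (1 : Matrix n n ℂ) := by
    rw [conjTranspose_sub, conjTranspose_smul, conjTranspose_one]
    simp only [sub_mul, mul_sub, Matrix.mul_smul, Matrix.smul_mul, mul_one, one_mul, smul_smul]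
    abel
  have hnn := groundStateFunctional_nonneg K (X - c • (1 : Matrix n n ℂ))
  rw [hexp, map_add, map_sub, map_sub, map_smul, map_smul, map_smul, groundStateFunctional_one hK,
    groundStateFunctional_conjTranspose, smul_eq_mul, smul_eq_mul, smul_eq_mul, mul_one, ← hc] at hnn
  obtain ⟨hre, -⟩ := Complex.nonneg_iff.mp hnn
  simp only [Complex.add_re, Complex.sub_re, Complex.mul_re, Complex.star_def, Complex.conj_re,
    Complex.conj_im] at hre
  nlinarith [hre, sq_nonneg c.im]

/-- Operator domination passes to the tracial ground state: if `Re⟨x, Aᴴ A x⟩ ≤ c · Re⟨x, W x⟩` for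
every vector (`W` Hermitian, `c` real) then `Re ω(Aᴴ A) ≤ c · Re ω(W)` — the matrix `c W - Aᴴ A` is
positive semidefinite and `ω` is a positive functional. [folklore] -/
private theorem re_groundStateFunctional_le_of_forall_re_le (K : Matrix n n ℂ) {W : Matrix n n ℂ}
    (hW : W.IsHermitian) (A : Matrix n n ℂ) (c : ℝ)
    (hdom : ∀ x : n → ℂ, (star x ⬝ᵥ (Aᴴ * A) *ᵥ x).re ≤ c * (star x ⬝ᵥ W *ᵥ x).re) :
    (K.groundStateFunctional (Aᴴ * A)).re ≤ c * (K.groundStateFunctional W).re := by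
  have hM : ((c : ℂ) • W - Aᴴ * A).IsHermitian := by
    refine (IsHermitian.smul hW ?_).sub (isHermitian_conjTranspose_mul_self A)
    rw [isSelfAdjoint_iff, Complex.star_def, Complex.conj_ofReal]
  have hPSD : ((c : ℂ) • W - Aᴴ * A).PosSemidef := by
    refine PosSemidef.of_dotProduct_mulVec_nonneg hM fun x => ?_
    refine Complex.nonneg_iff.2 ⟨?_, (hM.im_star_dotProduct_mulVec_self x).symm⟩
    rw [sub_mulVec, dotProduct_sub, smul_mulVec, dotProduct_smul, smul_eq_mul, Complex.sub_re,
      Complex.re_ofReal_mul]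
    linarith [hdom x]
  have h0 := groundStateFunctional_nonneg_of_posSemidef K hPSD
  rw [map_sub, map_smul, smul_eq_mul] at h0
  obtain ⟨hre, -⟩ := Complex.nonneg_iff.mp h0
  rw [Complex.sub_re, Complex.re_ofReal_mul] at hre
  linarith

/-- The abstract block slope: for Hermitian `T`, `W` and any `P` with `Re⟨x, PᴴP x⟩ ≤ c Re⟨x, W x⟩`
(`c > 0`), moving the coupling of `W` from `κ` to `κ - t` (`t ≥ 0`) lowers the ground energy by at
least `t (Re ω_{T + κW}(P))² / c`. [folklore] -/
private theorem groundEnergy_chord_le_of_domination [Nonempty n] {T W : Matrix n n ℂ}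
    (hT : T.IsHermitian) (hW : W.IsHermitian) (P : Matrix n n ℂ) {c : ℝ} (hc : 0 < c)
    (hdom : ∀ x : n → ℂ, (star x ⬝ᵥ (Pᴴ * P) *ᵥ x).re ≤ c * (star x ⬝ᵥ W *ᵥ x).re)
    (κ t : ℝ) (ht : 0 ≤ t) :
    (T + ((κ - t : ℝ) : ℂ) • W).groundEnergy - (T + (κ : ℂ) • W).groundEnergy ≤
      -t * ((T + (κ : ℂ) • W).groundStateFunctional P).re ^ 2 / c := by
  have hK : (T + (κ : ℂ) • W).IsHermitian := by
    refine hT.add (IsHermitian.smul hW ?_)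
    rw [isSelfAdjoint_iff, Complex.star_def, Complex.conj_ofReal]
  have hdecomp : T + ((κ - t : ℝ) : ℂ) • W = (T + (κ : ℂ) • W) - (t : ℂ) • W := by
    rw [Complex.ofReal_sub, sub_smul, add_sub_assoc]
  have hchord := sub_mul_re_groundStateFunctional_le hK hW 0 t
  simp only [Complex.ofReal_zero, zero_smul, sub_zero] at hchord
  have hdomω := re_groundStateFunctional_le_of_forall_re_le (T + (κ : ℂ) • W) hW P c hdom
  have hvar := re_sq_le_re_conjTranspose_mul_self hK P
  have hWge : ((T + (κ : ℂ) • W).groundStateFunctional P).re ^ 2 / c ≤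
      ((T + (κ : ℂ) • W).groundStateFunctional W).re := by
    rw [div_le_iff₀ hc]
    nlinarith [hvar, hdomω]
  have hmul := mul_le_mul_of_nonneg_left hWge ht
  have e : -t * ((T + (κ : ℂ) • W).groundStateFunctional P).re ^ 2 / c =
      -(t * (((T + (κ : ℂ) • W).groundStateFunctional P).re ^ 2 / c)) := by
    ring
  rw [hdecomp, e]
  linarith

end Abstract

/-- The Kac block operator `W_R = R⁻⁴ Σ_a B_aᴴ B_a` is Hermitian (a real multiple of a sum of
`XᴴX`'s). [folklore] -/
private theorem isHermitian_blockRepulsion (L : ℕ) [NeZero L] (R : ℕ) :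
    ((((((R : ℝ) ^ 4)⁻¹ : ℝ) : ℂ) • ∑ a : Literature.Probability.LatticeModels.TorusSite 2 L, (∑ u : Fin 2 → Fin R, localPair dWaveFormFactor L (a + fun i => ((u i : ℕ) : ZMod L)))ᴴ * (∑ u : Fin 2 → Fin R, localPair dWaveFormFactor L (a + fun i => ((u i : ℕ) : ZMod L))))).IsHermitian := by
  refine IsHermitian.smul ?_ ?_
  · exact (isSelfAdjoint_sum _ fun a _ =>
      (isHermitian_conjTranspose_mul_self _).isSelfAdjoint).isHermitian
  · rw [isSelfAdjoint_iff, Complex.star_def, Complex.conj_ofReal]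

/-- **Stub S1 — two-parameter Griffiths block slope at a repelled base point (finite `L`).**
On the attractive side of the base point `κ` the block perturbation lowers the SOURCED ground energy at rate
at least the squared sourced pair amplitude of the base Hamiltonian:
`E₀(T_h + (κ−t)W_R) − E₀(T_h + κW_R) ≤ −t (Re ω_{T_h+κW_R}(P))²/L²`, `t ≥ 0`, `R ≥ 1` — the variational
chord with the tracial ground state of `T_h + κW_R`, `Re ω(W_R) ≥ Re ω(PᴴP)/L²` (block coherence
dominates pair order) and the variance bound `Re ω(PᴴP) ≥ (Re ω(P))²`. [cite: KomaTasaki1994, §1] -/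
theorem stub_blockSlope :
    ∀ (L : ℕ) [NeZero L] (R : ℕ), 0 < R → ∀ (U μ h κ t : ℝ), 0 ≤ t →
      (dWaveSourceTorus L U μ h + ((κ - t : ℝ) : ℂ) • (((((R : ℝ) ^ 4)⁻¹ : ℝ) : ℂ) • ∑ a : Literature.Probability.LatticeModels.TorusSite 2 L, (∑ u : Fin 2 → Fin R, localPair dWaveFormFactor L (a + fun i => ((u i : ℕ) : ZMod L)))ᴴ * (∑ u : Fin 2 → Fin R, localPair dWaveFormFactor L (a + fun i => ((u i : ℕ) : ZMod L))))).groundEnergy -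
          (dWaveSourceTorus L U μ h + (κ : ℂ) • (((((R : ℝ) ^ 4)⁻¹ : ℝ) : ℂ) • ∑ a : Literature.Probability.LatticeModels.TorusSite 2 L, (∑ u : Fin 2 → Fin R, localPair dWaveFormFactor L (a + fun i => ((u i : ℕ) : ZMod L)))ᴴ * (∑ u : Fin 2 → Fin R, localPair dWaveFormFactor L (a + fun i => ((u i : ℕ) : ZMod L))))).groundEnergy ≤
        -t * ((dWaveSourceTorus L U μ h + (κ : ℂ) • (((((R : ℝ) ^ 4)⁻¹ : ℝ) : ℂ) • ∑ a : Literature.Probability.LatticeModels.TorusSite 2 L, (∑ u : Fin 2 → Fin R, localPair dWaveFormFactor L (a + fun i => ((u i : ℕ) : ZMod L)))ᴴ * (∑ u : Fin 2 → Fin R, localPair dWaveFormFactor L (a + fun i => ((u i : ℕ) : ZMod L))))).groundStateFunctional (pairField dWaveFormFactor L)).re ^ 2 / (L : ℝ) ^ 2 := by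
  intro L _ R hR U μ h κ t ht
  exact groundEnergy_chord_le_of_domination
    (dWaveSourceTorus_isHermitian L (isHermitian_hubbardTorusWith L 1 U μ) h)
    (isHermitian_blockRepulsion L R) (pairField dWaveFormFactor L) (cast_sq_pos_of_neZero L)
    (fun x => re_expect_pairIntensity_le_sq_mul_blockRepulsion L R hR x) κ t ht

end Summit.HubbardSuperconductivity.HubbardSuperconductivity.Theorems.CwSsbToEvenTorusLRO

end
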